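import Mathlib
import Summits.Ventures.HodgeRepro2.T5PropGSkeleton
import Summits.Ventures.HodgeRepro2.T5PropGArithmetic

/-!
# T6N5PropG — route-3's Proposition G (the (c)-side of N5: four cofinite non-vanishing statements)
as a glue skeleton over p7's `T5PropGSkeleton` / `T5PropGArithmetic`, carrier-free

Tier 6 (README §10), sub-step N5 of the M2 discharge (TARGET-T6 §3 row N5, §4 L4; t6-p7).  The record
formalised is route/T5-route-3.md v0.4 §G = TIER5.md ll. 505–546 (Proposition G, chain S0–S8), adopted
by N5 at TIER5 §N5.12 (l. 2231 (3)): for each of the four line characters λ_i, the central values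
L(1, λ_iν) are non-zero for all but finitely many ν ∈ Ξ_𝔭, from

* [P1] Hsieh, J. reine angew. Math. 688 (2014) Thm 1 = Thm 6.5 (μ(ℒ^-_{χ,Σ}) = Σ_{v|ℭ⁻} μ_p(χ_v) when
  W(χ^*) = 1) — step S4;
* [P2] Burungale–Hida, Algebra Number Theory 11 (2017) Thm B = Thm 6.1 (μ(L^-_{Σ,λ}) = μ(L^-_{Σ,λ,𝔭}))
  — step S1;
* [P3] the Weierstrass preparation theorem (Hida, Elementary Modular Iwasawa Theory, Thm 1.10.3;
  Coates–Sujatha Thm 2.1.3) — step S5;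
* [P4] the Katz–Hida–Tilouine interpolation formula as printed in Hsieh (1.1) — step S6;

glued by the one-line steps [A-0]–[A-7] (S0 set-up, S2 the base character, S3 sign constancy, [A-3]
twist invariance, S7 the union of the exceptional sets, S8 the sign of the twisted character).

p7's `T5PropGSkeleton` already proves the LOGICAL skeleton: `FinitelyManyZeros d` (S1–S5) and
`InterpolationTransfer d` (S6) give `CofiniteNonvanishing d` (i), and `propG` assembles (i)–(iii).
This file adds the layer BELOW it: the μ-invariant bookkeeping of S1–S4 (Hsieh ⇒ μ^- finite; the
twist step; Burungale–Hida ⇒ the 𝔭-line μ finite ⇒ the 𝔭-line measure non-zero) as a structure of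
hypotheses (`GBranch.Hyps`) in exactly the shapes the M2 displays of [P1], [P2], [P4] will deliver, with
S5 (a non-zero measure kills only finitely many twists) taken as ONE field — discharged in p7's
measure model by `T5PropGBranchMeasure.finitelyManyZeros_branchData` (Amice transform + p8's
Weierstrass zero count; LEAN-ANNEX-p7 rows 74–78) or by `finitelyManyZeros_of_weierstrass` below on
an explicit coordinate — and the theorem that those hypotheses yield
`FinitelyManyZeros ∧ InterpolationTransfer`, hence `CofiniteNonvanishing`, for the branch.  No
display lives here (no `[cite:` docstring); every printed input is a FIELD of `GBranch.Hyps`, to be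
discharged at M2 from the display file by name.  Nothing p-adic-analytic is constructed.

§8(d): uses an L-value-free non-vanishing device: NO.
-/

namespace Summit.Ventures.HodgeRepro2.T6.N5PropG

open Summit.Ventures.HodgeRepro2.T5PropGSkeleton Summit.Ventures.HodgeRepro2.T5PropGArithmetic

/-- One branch λ = λ_i of Proposition G with its μ-invariant / Weierstrass data (TIER5 §G S1–S5), over
p7's `BranchData Ξ K` (the twist family Ξ = Ξ_𝔭, the 𝔭-line measure's values `m ν = ∫ ν dL^-_{Σ,λ⁻¹,𝔭}`
in the coefficient field `K` (= the fraction field of 𝒪), the central values `L ν = L(1, λν)`, the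
inversion `inv : Ξ ≃ Ξ` of the twists).  `ι` indexes the places of the CM field. -/
structure GBranch (ι Ξ K : Type*) [Field K] extends BranchData Ξ K where
  /-- the places v | ℭ⁻ (the inert / ramified prime factors of the prime-to-p conductor ℭ of χ). -/
  condMinus : Finset ι
  /-- μ_p(χ_v) := inf_{x ∈ 𝒦_v^×} v_p(χ_v(x) − 1), the local invariants of Hsieh's Theorem A. -/
  muLoc : ι → ℕ∞
  /-- μ(ℒ^-_{χ,Σ}) = Hsieh's μ^-_{χ,Σ} of the base character χ = χ_i (S2). -/
  muHsieh : ℕ∞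
  /-- μ(L^-_{Σ,λ⁻¹}): Burungale–Hida's μ-invariant of the λ⁻¹-branch on Γ^-. -/
  muBH : ℕ∞
  /-- μ(L^-_{Σ,λ⁻¹,𝔭}): Burungale–Hida's μ-invariant of the 𝔭-line measure on Γ_𝔭. -/
  muBHp : ℕ∞
  /-- W(χ̌) = ε(λ), the global root number (S3: constant along the branch). -/
  rootNumber : ℤ
  /-- «the 𝔭-line measure L^-_{Σ,λ⁻¹,𝔭} is non-zero» — in p7's measure model
  (T5PropGBranchMeasure) this is `m ≠ 0` for the continuous functional m whose values on the
  twists are `toBranchData.m`. -/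
  measureNeZero : Prop

namespace GBranch

variable {ι Ξ K : Type*} [Field K]

/-- The hypotheses of Proposition G on one branch, in the shapes the M2 displays deliver
(TIER5 §G S1–S6; each field names its source). -/
structure Hyps (b : GBranch ι Ξ K) : Prop where
  /-- [P1] Hsieh Thm 1 = Thm 6.5 (S4): W(χ̌) = 1 ⇒ μ(ℒ^-_{χ,Σ}) = Σ_{v|ℭ⁻} μ_p(χ_v). -/
  hsieh : b.rootNumber = 1 → b.muHsieh = ∑ v ∈ b.condMinus, b.muLoc v
  /-- S4 [A]: each local invariant is finite (v | ℭ⁻ ⇒ χ_v ≠ 1; `local_mu_lt_top`). -/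
  local_finite : ∀ v ∈ b.condMinus, b.muLoc v < ⊤
  /-- S3 / (H4): the root number of the branch is +1 (= (R-sign), TIER5 §N5.5(c)). -/
  sign : b.rootNumber = 1
  /-- [A-3]: the λ⁻¹-branch and the χ-branch differ by a unit character, so their μ-invariants on
  Γ^- agree (`mu_twist_invariant`). -/
  twist : b.muBH = b.muHsieh
  /-- [P2] Burungale–Hida Thm B = Thm 6.1 (S1): μ(L^-_{Σ,λ⁻¹}) = μ(L^-_{Σ,λ⁻¹,𝔭}). -/
  bh : b.muBH = b.muBHp
  /-- S1 [A]: a measure of finite μ-invariant is non-zero (μ(ϕ) = ⊤ ⟺ ϕ = 0; `mu_eq_top_iff`). -/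
  nonzero : b.muBHp < ⊤ → b.measureNeZero
  /-- S5 (Weierstrass preparation through the Amice transform): a non-zero measure on the 𝔭-line
  kills only finitely many twists — p7's `finitelyManyZeros_branchData` in the measure model, or
  `finitelyManyZeros_of_weierstrass` below on an explicit coordinate. -/
  finite_of_nonzero : b.measureNeZero → FinitelyManyZeros b.toBranchData
  /-- [P4] Hsieh (1.1) + S6 [A-5]: a non-zero p-adic value forces the complex central value of the
  inverse twist to be non-zero (= `InterpolationTransfer`). -/
  interp : ∀ ν, b.m ν ≠ 0 → b.L (b.inv ν) ≠ 0

variable {b : GBranch ι Ξ K}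

/-- S4: under [P1] and the sign, Hsieh's μ-invariant is finite (a finite sum of finite terms). -/
theorem muHsieh_lt_top (h : b.Hyps) : b.muHsieh < ⊤ := by
  rw [h.hsieh h.sign]
  exact mu_sum_lt_top b.condMinus b.muLoc h.local_finite

/-- S1 + [A-3]: the 𝔭-line μ-invariant is finite. -/
theorem muBHp_lt_top (h : b.Hyps) : b.muBHp < ⊤ := by
  rw [← h.bh, h.twist]
  exact muHsieh_lt_top h

/-- S1: the 𝔭-line measure is non-zero. -/
theorem measure_ne_zero (h : b.Hyps) : b.measureNeZero :=
  h.nonzero (muBHp_lt_top h)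

/-- S5: the 𝔭-line measure vanishes on only finitely many twists —
`T5PropGSkeleton.FinitelyManyZeros` for the branch. -/
theorem finitelyManyZeros (h : b.Hyps) : FinitelyManyZeros b.toBranchData :=
  h.finite_of_nonzero (measure_ne_zero h)

/-- S6: `T5PropGSkeleton.InterpolationTransfer` for the branch is the field `interp`. -/
theorem interpolationTransfer (h : b.Hyps) : InterpolationTransfer b.toBranchData :=
  fun ν hν => h.interp ν hν

/-- Proposition G (i) for the branch: the central values L(1, λν) vanish for only finitely many
twists ν — `T5PropGSkeleton.CofiniteNonvanishing`, through p7's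
`cofinite_of_finitelyManyZeros_of_transfer`. -/
theorem cofiniteNonvanishing (h : b.Hyps) :
    CofiniteNonvanishing b.toBranchData :=
  cofinite_of_finitelyManyZeros_of_transfer b.toBranchData (finitelyManyZeros h)
    (interpolationTransfer h)

/-- S5 read through the Weierstrass preparation theorem on an explicit coordinate (TIER5 §G S5;
Coates–Sujatha §2.1 / Hida §1.10): if the values of the 𝔭-line measure on the twists are
`m ν = f(coord ν)` with `f = c·P·U` on the open unit disc (`c ≠ 0`, `P ≠ 0` a polynomial, `U` without
zero on the disc) and `coord` injective into the disc, then only finitely many twists are zeros — the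
alternative discharge of the field `finite_of_nonzero` when the Amice model is not in play. -/
theorem finitelyManyZeros_of_weierstrass [DecidableEq K] (d : BranchData Ξ K) (coord : Ξ → K)
    (disc : Set K) (f : K → K) (c : K) (P : Polynomial K) (U : K → K) (hc : c ≠ 0) (hP : P ≠ 0)
    (hU : ∀ x ∈ disc, U x ≠ 0) (hf : ∀ x ∈ disc, f x = c * P.eval x * U x)
    (heval : ∀ ν, d.m ν = f (coord ν)) (hinj : Function.Injective coord)
    (hmem : ∀ ν, coord ν ∈ disc) : FinitelyManyZeros d := by
  have hzero : {ν | d.m ν = 0} = {ν | c * P.eval (coord ν) * U (coord ν) = 0} := by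
    ext ν
    simp only [Set.mem_setOf_eq, heval ν, hf (coord ν) (hmem ν)]
  unfold FinitelyManyZeros
  rw [hzero]
  exact (zeros_finite_and_card_le_natDegree P hP c hc U disc hU coord hinj hmem).1

end GBranch

/-- Proposition G (ii) for a finite family of branches (the four line characters): every branch's
hypotheses ⇒ the product of the central values vanishes for only finitely many twists
(p7's `prod_cofinite`). -/
theorem prod_cofinite_of_hyps {ι Ξ K : Type*} [Field K] {J : Type*} (I : Finset J)
    (b : J → GBranch ι Ξ K) (h : ∀ i ∈ I, (b i).Hyps) :
    {ν | ∏ i ∈ I, (b i).L ν = 0}.Finite :=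
  prod_cofinite I (fun i => (b i).toBranchData) fun i hi => GBranch.cofiniteNonvanishing (h i hi)

/-- Proposition G (ii) + an infinite twist family: ONE twist serves every branch (the admissible
choice of [G-N5.1], TIER5 §N5.8). -/
theorem exists_twist_of_hyps {ι Ξ K : Type*} [Field K] {J : Type*}
    (hΞ : (Set.univ : Set Ξ).Infinite) (I : Finset J) (b : J → GBranch ι Ξ K)
    (h : ∀ i ∈ I, (b i).Hyps) : ∃ ν : Ξ, ∀ i ∈ I, (b i).L ν ≠ 0 := by
  obtain ⟨Z, hZ, hgood⟩ := exists_finite_forall_ne_zero I (fun i => (b i).toBranchData)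
    fun i hi => GBranch.cofiniteNonvanishing (h i hi)
  obtain ⟨ν, -, hν⟩ := (hΞ.sdiff hZ).nonempty
  exact ⟨ν, hgood ν hν⟩

end Summit.Ventures.HodgeRepro2.T6.N5PropG
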